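import Summits.KontsevichZagierPeriods.KontsevichZagierPeriods.Theorems.SoloBlindCyclicGreen
import Summits.KontsevichZagierPeriods.KontsevichZagierPeriods.Theorems.SoloBlindBeta
import HarnessLib

/-!
# The cyclic Beta relation `sin(πa) B(a,c) = sin(πb) B(b,c)` inside the rules

For `a = k/N`, `b = l/N`, `k, l ≥ 1`, `k + l < N`, `c = 1 - a - b`:

  `sin(πa) • [β(a, c)] = sin(πb) • [β(b, c)]`  in  `Q = 𝓟_formal ⊗ K₀`,

obtained from the axioms (1)–(3) of Kontsevich–Zagier only: Green's formula for the closed forms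
`z^{a-1}(1-z)^{b-1} dz` and `z^{b-1}(1-z)^{a-1} dz` on the half-plane `{x < ½, y > 0}`
(`SoloBlindGreenA`), the coincidence of their traces on `x = ½` (`SoloBlindCyclicGreen`), the
boundary value `-Im (x^{a-1}(1-x)^{b-1}) = sin(πa) (-x)^{a-1}(1-x)^{b-1}` on `x < 0`, and the
substitution `x = -v/(1-v)` carrying `[(-∞,0), (-x)^{a-1}(1-x)^{b-1}]` to `β(a, c)`.
Numerically this is `Γ(a)Γ(b)Γ(c) sin(πa) sin(πb) / π` written in two ways; in `Q` it says that
the three Beta values of an `S₃`-orbit `{a, b, c}`, `a + b + c = 1`, span a line.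

References: Kontsevich–Zagier, *Periods* (2001), §1.2; Whittaker–Watson, §12.41.
-/

noncomputable section

open Set Complex MeasureTheory
open Literature.ModelTheory.ExponentialFields MvPolynomial
open Literature.NumberTheory.Transcendental
open Literature.NumberTheory.Transcendental.KZ
open Literature.Analysis.SpecialFunctions.Selberg

namespace Summit.KontsevichZagierPeriods.KontsevichZagierPeriods.Theorems

namespace SoloBlind

/-! ## The sine scalars -/

/-- `sin(π(a-1)) = -sin(πa)` for `a = k/N`. -/
theorem sin_pi_mul_cycExp (N k : ℕ) :
    Real.sin (Real.pi * cycExp N k) = -Real.sin (Real.pi * ((k : ℝ) / N)) := by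
  rw [cycExp, mul_sub, mul_one, Real.sin_sub_pi]

/-- `sin(π k/N)` is real algebraic. -/
theorem isAlgebraic_sinFrac (N k : ℕ) : IsAlgebraic ℚ (Real.sin (Real.pi * ((k : ℝ) / N))) := by
  have h := (Real.isAlgebraic_sin_rat_mul_pi ((k : ℚ) / N)).extendScalars
    (R := ℤ) (S := ℚ) (A := ℝ) (RingHom.injective_int (algebraMap ℤ ℚ))
  rw [show (((k : ℚ) / N : ℚ) : ℝ) * Real.pi = Real.pi * ((k : ℝ) / N) by push_cast; ring] at h
  exact h

/-- The real algebraic number `sin(π k/N)` as a scalar in `K₀`. -/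
def sinK (N k : ℕ) : K₀ :=
  ⟨Real.sin (Real.pi * ((k : ℝ) / N)), mem_K₀_iff.mpr (isAlgebraic_sinFrac N k)⟩

/-- `(sinK N k : ℝ) = sin(π k/N)`. -/
theorem sinK_val (N k : ℕ) : (sinK N k : ℝ) = Real.sin (Real.pi * ((k : ℝ) / N)) := rfl

namespace CycData

variable (d : CycData)

/-! ## The negative half-line representation and the substitution -/

/-- `N⁻ = [(-∞,0), (-x)^{a-1} (1-x)^{b-1}]`. -/
def negRep₂ : IntegralRep 1 :=
  lineRep (Iio 0) (fun x => (-x) ^ cycExp d.N d.k * (1 - x) ^ cycExp d.N d.l)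
    (isSemialgebraic_line_Iio isAlgebraic_zero)
    ((isSemialgebraicFunOn_mellinIntegrand (isSemialgebraic_line_Iio isAlgebraic_zero)
      ![-X 0, 1 - X 0] ![(d.k : ℚ) / d.N - 1, (d.l : ℚ) / d.N - 1] 1 (fun x hx j => by
        have hx' : x 0 < 0 := hx
        fin_cases j
        · simpa using hx'
        · simp only [Fin.mk_one, Matrix.cons_val_one, Matrix.cons_val_fin_one, map_sub, map_one,
            MvPolynomial.aeval_X, sub_pos]
          linarith)).congr fun x _ => by
        rw [mellinIntegrand_apply, Fin.prod_univ_two]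
        simp only [Matrix.cons_val_zero, Matrix.cons_val_one, Matrix.cons_val_fin_one, map_neg,
          map_sub, map_one, MvPolynomial.aeval_X, Rat.cast_one, one_mul, cycExp_cast])
    (integrableOn_negSide₂ d.exp_bounds.1.1 d.exp_bounds.2.2)

/-- **`[E⁻] ≡ sin(πa) • N⁻`**: the boundary value `-Im g_{αβ}(x) = sin(πa)(-x)^{a-1}(1-x)^{b-1}`
on `x < 0`. -/
theorem edgeNegPart_sub_constMul_negRep₂ :
    of d.datum.edgeNegPart - of (d.negRep₂.constMul (Real.sin (Real.pi * ((d.k : ℝ) / d.N)))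
      (isAlgebraic_sinFrac d.N d.k)) ∈ relations := by
  refine of_sub_of_mem_relations_of_eqOn rfl fun x hx => ?_
  have hx' : x 0 < 0 := hx
  simp only [GreenDatum.edgeNegPart, IntegralRep.integrand_restrict, GreenDatum.edgeRep,
    lineRep_integrand, IntegralRep.integrand_constMul, negRep₂]
  rw [GreenDatum.edge_apply, datum_g, im_gTwo_ofReal_neg hx', sin_pi_mul_cycExp]
  ring

/-- `a = k/N > 0` and `c = 1 - a - b > 0`. -/
theorem pos : 0 < (d.k : ℚ) / d.N ∧ 0 < 1 - (d.k : ℚ) / d.N - (d.l : ℚ) / d.N := by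
  have hN : (0 : ℚ) < d.N := by
    have h : 0 < d.N := lt_of_le_of_lt (Nat.zero_le _) d.hkl
    exact_mod_cast h
  have hk : (0 : ℚ) < d.k := by exact_mod_cast d.hk
  have hkl : (d.k : ℚ) + d.l < d.N := by exact_mod_cast d.hkl
  refine ⟨div_pos hk hN, ?_⟩
  have h : ((d.k : ℚ) + d.l) / d.N < 1 := (div_lt_one hN).mpr hkl
  rw [add_div] at h
  linarith

/-- **Rule (2) along `x = -v/(1-v)`**: `β(a, c) ≡ N⁻`. -/
theorem betaRep_sub_negRep₂ :
    of (betaRep ((d.k : ℚ) / d.N) (1 - (d.k : ℚ) / d.N - (d.l : ℚ) / d.N) d.pos.1 d.pos.2) -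
      of d.negRep₂ ∈ relations := by
  have h1 : ((((d.k : ℚ) / d.N : ℚ) : ℝ) - 1) = cycExp d.N d.k := by
    rw [cycExp]; push_cast; ring
  have h2 : ((((1 - (d.k : ℚ) / d.N - (d.l : ℚ) / d.N : ℚ)) : ℝ) - 1) =
      -cycExp d.N d.k - cycExp d.N d.l - 2 := by
    simp only [cycExp]; push_cast; ring
  refine lineRep_subst (fun v => -moeb v) (fun v => -(1 / (1 - v) ^ 2)) ?_
    (fun v hv => (hasDerivAt_moeb (ne_of_lt hv.2)).neg.hasDerivWithinAt) injOn_negMoeb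
    image_negMoeb.symm fun v hv => ?_
  · refine (isSemialgebraicFunOn_aeval_div_aeval
      (isSemialgebraic_line_Ioo isAlgebraic_zero isAlgebraic_one) (-X 0) (1 - X 0)
      fun x hx => ?_).congr fun x _ => ?_
    · have hx' : 0 < x 0 ∧ x 0 < 1 := hx
      simpa [sub_eq_zero] using (ne_of_lt hx'.2).symm
    · simp [moeb, neg_div]
  · have h1v : 0 < 1 - v := by linarith [hv.2]
    rw [h1, h2, abs_neg, abs_of_pos (by positivity : (0 : ℝ) < 1 / (1 - v) ^ 2),
      jacobi_negMoeb₂ _ _ hv]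

/-- **`[E⁻(k,l)] = sin(πa) • β(a, c)` in `Q`.** -/
theorem mkQ_edgeNegPart :
    mkQ (of d.datum.edgeNegPart) =
      sinK d.N d.k • betaQ ((d.k : ℚ) / d.N) (1 - (d.k : ℚ) / d.N - (d.l : ℚ) / d.N) := by
  have h : mkQ (of d.datum.edgeNegPart) =
      (⟨Real.sin (Real.pi * ((d.k : ℝ) / d.N)), mem_K₀_iff.mpr (isAlgebraic_sinFrac d.N d.k)⟩ :
        K₀) • betaQ ((d.k : ℚ) / d.N) (1 - (d.k : ℚ) / d.N - (d.l : ℚ) / d.N) := by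
    rw [mkQ_eq_mkQ_iff.mpr d.edgeNegPart_sub_constMul_negRep₂, mkQ_constMul,
      betaQ_eq d.pos.1 d.pos.2, mkQ_eq_mkQ_iff.mpr d.betaRep_sub_negRep₂]
  exact h

/-! ## The headline relation -/

/-- **The cyclic Beta relation inside the rules** (level-`N` form): for `k, l ≥ 1`, `k + l < N`,
`a = k/N`, `b = l/N`, `c = 1 - a - b`,

  `sin(πa) • [β(a, c)] = sin(πb) • [β(b, c)]`  in `Q`. -/
theorem betaQ_cyclic :
    sinK d.N d.k • betaQ ((d.k : ℚ) / d.N) (1 - (d.k : ℚ) / d.N - (d.l : ℚ) / d.N) =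
      sinK d.N d.l • betaQ ((d.l : ℚ) / d.N) (1 - (d.k : ℚ) / d.N - (d.l : ℚ) / d.N) := by
  have h1 := d.mkQ_edgeNegPart
  have h2 : mkQ (of d.swap.datum.edgeNegPart) =
      sinK d.N d.l • betaQ ((d.l : ℚ) / d.N) (1 - (d.l : ℚ) / d.N - (d.k : ℚ) / d.N) :=
    d.swap.mkQ_edgeNegPart
  have h3 : mkQ (of d.datum.edgeNegPart) = mkQ (of d.swap.datum.edgeNegPart) :=
    mkQ_eq_mkQ_iff.mpr d.edgeNegPart_swap
  rw [show 1 - (d.l : ℚ) / d.N - (d.k : ℚ) / d.N = 1 - (d.k : ℚ) / d.N - (d.l : ℚ) / d.N by ring]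
    at h2
  exact h1.symm.trans (h3.trans h2)

end CycData

/-! ## Rational form -/

/-- The real algebraic number `sin(πa)`, `a ∈ ℚ`, as a scalar in `K₀`. -/
def sinQ (a : ℚ) : K₀ :=
  ⟨Real.sin (Real.pi * a), mem_K₀_iff.mpr (by
    have h := (Real.isAlgebraic_sin_rat_mul_pi a).extendScalars
      (R := ℤ) (S := ℚ) (A := ℝ) (RingHom.injective_int (algebraMap ℤ ℚ))
    rwa [mul_comm] at h)⟩

/-- `(sinQ a : ℝ) = sin(πa)`. -/
theorem sinQ_val (a : ℚ) : (sinQ a : ℝ) = Real.sin (Real.pi * a) := rfl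

/-- `sinK N k = sinQ (k/N)`. -/
theorem sinK_eq_sinQ (N k : ℕ) : sinK N k = sinQ ((k : ℚ) / N) :=
  Subtype.ext (by rw [sinK_val, sinQ_val]; push_cast; ring_nf)

/-- Two positive rationals with sum `< 1` are `k/N`, `l/N` for cyclic data. -/
theorem exists_cycData (a b : ℚ) (ha : 0 < a) (hb : 0 < b) (hab : a + b < 1) :
    ∃ d : CycData, (d.k : ℚ) / d.N = a ∧ (d.l : ℚ) / d.N = b := by
  have hda : (0 : ℚ) < a.den := by exact_mod_cast a.den_pos
  have hdb : (0 : ℚ) < b.den := by exact_mod_cast b.den_pos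
  have hna : 0 < a.num := Rat.num_pos.mpr ha
  have hnb : 0 < b.num := Rat.num_pos.mpr hb
  have hk : ((a.num.toNat * b.den : ℕ) : ℚ) = a * (a.den * b.den) := by
    have h : ((a.num.toNat : ℕ) : ℚ) = (a.num : ℚ) := by exact_mod_cast Int.toNat_of_nonneg hna.le
    push_cast
    rw [h, ← mul_assoc, Rat.mul_den_eq_num]
  have hl : ((b.num.toNat * a.den : ℕ) : ℚ) = b * (a.den * b.den) := by
    have h : ((b.num.toNat : ℕ) : ℚ) = (b.num : ℚ) := by exact_mod_cast Int.toNat_of_nonneg hnb.le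
    push_cast
    rw [h, mul_comm (a.den : ℚ), ← mul_assoc, Rat.mul_den_eq_num]
  have hkpos : 0 < a.num.toNat * b.den := by
    have h : (0 : ℚ) < ((a.num.toNat * b.den : ℕ) : ℚ) := by rw [hk]; positivity
    exact_mod_cast h
  have hlpos : 0 < b.num.toNat * a.den := by
    have h : (0 : ℚ) < ((b.num.toNat * a.den : ℕ) : ℚ) := by rw [hl]; positivity
    exact_mod_cast h
  have hkl : a.num.toNat * b.den + b.num.toNat * a.den < a.den * b.den := by
    have h : ((a.num.toNat * b.den : ℕ) : ℚ) + ((b.num.toNat * a.den : ℕ) : ℚ) <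
        ((a.den * b.den : ℕ) : ℚ) := by
      rw [hk, hl, ← add_mul]
      have hN' : (0 : ℚ) < a.den * b.den := by positivity
      push_cast
      nlinarith
    exact_mod_cast h
  refine ⟨⟨a.den * b.den, a.num.toNat * b.den, b.num.toNat * a.den, hkpos, hlpos, hkl⟩, ?_, ?_⟩
  · show ((a.num.toNat * b.den : ℕ) : ℚ) / ((a.den * b.den : ℕ) : ℚ) = a
    rw [hk, Nat.cast_mul, mul_div_assoc, div_self (by positivity), mul_one]
  · show ((b.num.toNat * a.den : ℕ) : ℚ) / ((a.den * b.den : ℕ) : ℚ) = b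
    rw [hl, Nat.cast_mul, mul_div_assoc, div_self (by positivity), mul_one]

/-- **The cyclic Beta relation inside the rules**: for rationals `a, b > 0` with `a + b < 1` and
`c = 1 - a - b`,

  `sin(πa) • [β(a, c)] = sin(πb) • [β(b, c)]`  in  `Q`.

Equivalently (with `β(x,y) = β(y,x)`): the Beta values `β(a,b), β(b,c), β(c,a)` of an
`S₃`-orbit `a + b + c = 1` are pairwise proportional over the real algebraic numbers, by the
Kontsevich–Zagier rules alone. -/
theorem betaQ_cyclic_rat (a b : ℚ) (ha : 0 < a) (hb : 0 < b) (hab : a + b < 1) :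
    sinQ a • betaQ a (1 - a - b) = sinQ b • betaQ b (1 - a - b) := by
  obtain ⟨d, hk, hl⟩ := exists_cycData a b ha hb hab
  have h := d.betaQ_cyclic
  rw [sinK_eq_sinQ, sinK_eq_sinQ, hk, hl] at h
  exact h

/-- **The `S₃`-orbit form**: for `a, b, c > 0` rational with `a + b + c = 1`:
`sin(πa) β(a,c) = sin(πb) β(b,c)`, `sin(πb) β(b,a) = sin(πc) β(c,a)`,
`sin(πc) β(c,b) = sin(πa) β(a,b)` in `Q`. -/
theorem betaQ_orbit (a b c : ℚ) (ha : 0 < a) (hb : 0 < b) (hc : 0 < c) (habc : a + b + c = 1) :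
    sinQ a • betaQ a c = sinQ b • betaQ b c ∧ sinQ b • betaQ b a = sinQ c • betaQ c a ∧
      sinQ c • betaQ c b = sinQ a • betaQ a b := by
  refine ⟨?_, ?_, ?_⟩
  · have h := betaQ_cyclic_rat a b ha hb (by linarith)
    rwa [show 1 - a - b = c by linarith] at h
  · have h := betaQ_cyclic_rat b c hb hc (by linarith)
    rwa [show 1 - b - c = a by linarith] at h
  · have h := betaQ_cyclic_rat c a hc ha (by linarith)
    rwa [show 1 - c - a = b by linarith] at h

/-- **The diagonal case for every rational `0 < a < ½`**: `sin(πa) β(a,a) = sin(2πa) β(1-2a, a)`,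
i.e. `β(a,a) = 2cos(πa) β(a, 1-2a)` — the level-5 relations of `SoloBlindCauchyBeta` for all
levels at once. -/
theorem betaQ_diag_rat (a : ℚ) (ha : 0 < a) (h2a : 2 * a < 1) :
    sinQ (1 - 2 * a) • betaQ (1 - 2 * a) a = sinQ a • betaQ a a := by
  have h := (betaQ_orbit a a (1 - 2 * a) ha ha (by linarith) (by ring)).2.2
  exact h

end SoloBlind

end Summit.KontsevichZagierPeriods.KontsevichZagierPeriods.Theorems
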